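import Literature.Analysis.UnboundedOperators.LinearizedBoltzmannFibreReduction
import Literature.Analysis.UnboundedOperators.LinearizedBoltzmannPseudoMaxwellianGap
import Literature.Probability.Distributions.GaussianPolynomialDensity
import Literature.Analysis.UnboundedOperators.LinearizedBoltzmannPositivityProofs
import HarnessLib

/-!
# The spectral gap of the linearised hard-sphere Boltzmann operator

Discharge of `LinearizedBoltzmann.le_neg_maxwellianInner_hardSphereLinearizedOp_of_orthogonal`:
in dimension `d ≥ 2` there is `λ > 0` with `-⟨g, Lg⟩_M ≥ λ ⟨g, g⟩_M` for every `g` of temperate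
growth orthogonal to the collision invariants (`L` the linearised hard-sphere operator around the
normalised Maxwellian).

## Proof architecture

Write `Q(g) = ∫_S ∫ (R_ω g)² d((γ₁⊗γ₁)⊗(γ⊗γ)) dσ(ω)` for the sphere-averaged rectangle form
(`GaussianRectangleForm.rectIncr`) and `N(g) = ∫ g² dγ`.

* **Step B/C** (`LinearizedBoltzmannFibreReduction`): `Q(g) ≤ 8 C₁ (-⟨g, Lg⟩_M)`, `C₁` the Gaussian
  hard-rod constant — fibre decomposition `v = cω + P_ω z` and the one-dimensional coercivity.
* **Step D** (`LinearizedBoltzmannPseudoMaxwellianGap`): `Q(𝓗_b p) ≥ κ_d ‖p‖²_F = κ_d N(𝓗_b p)` for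
  Wick polynomials `𝓗_b p` orthogonal to the invariants, `κ_d = 16σ(S)(d-1)/(3d(d+2))`.
* **Extension** (this file): `√Q` and `√N` are `L²` seminorms, `√Q ≤ 4√σ(S) √N`
  (`eLpNorm_rectIncr_le`), polynomials are dense in `L²(γ)` (`GaussianPolynomialDensity`) and the
  approximating polynomial can be corrected inside the (finite-dimensional) space of invariants
  (`exists_orthogonal_poly_approx`); hence `Q(g) ≥ κ_d N(g)` for all temperate `g ⊥` invariants
  (`kappa_mul_lintegral_sq_le_rectForm`), and `λ = κ_d / (8 C₁)` works.

References: Grad 1963 (statement); the proof formalised here is the fibre/pseudo-Maxwellian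
argument (Baranger–Mouhot 2005 for the geometry of the fibres), made quantitative through the
Wick-polynomial calculus of Janson 1997.
-/

open MeasureTheory Metric Real Set ProbabilityTheory Module Finset
open scoped InnerProductSpace ENNReal NNReal

namespace Literature.Analysis.UnboundedOperators

noncomputable section

open Literature.MathematicalPhysics.KineticTheory (sphereMeasure)
open Literature.Analysis.FluidPDE
open Literature.Algebra.Polynomial Literature.Probability.Distributions

/-! ### `L²` seminorms as `lintegral`s -/

section Seminorm

variable {α : Type*} [MeasurableSpace α]

/-- `‖f‖²_{L²(μ)} = ∫ f² dμ` (as extended nonnegative reals). [folklore] -/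
theorem eLpNorm_two_sq_eq_lintegral (f : α → ℝ) (μ : Measure α) :
    eLpNorm f 2 μ ^ 2 = ∫⁻ x, ENNReal.ofReal (f x ^ 2) ∂μ := by
  rw [eLpNorm_eq_lintegral_rpow_enorm_toReal two_ne_zero ENNReal.ofNat_ne_top]
  have h2 : (2 : ℝ≥0∞).toReal = 2 := by norm_num
  rw [h2]
  have hin : ∀ x, ‖f x‖ₑ ^ (2 : ℝ) = ENNReal.ofReal (f x ^ 2) := fun x => by
    rw [Real.enorm_eq_ofReal_abs, show (2 : ℝ) = ((2 : ℕ) : ℝ) by norm_num, ENNReal.rpow_natCast,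
      ← ENNReal.ofReal_pow (abs_nonneg _), sq_abs]
  simp_rw [hin]
  rw [← ENNReal.rpow_natCast, ← ENNReal.rpow_mul]
  norm_num

/-- `‖f‖_{L²(μ)} = (∫ f² dμ)^{1/2}`. [folklore] -/
theorem eLpNorm_two_eq_rpow (f : α → ℝ) (μ : Measure α) :
    eLpNorm f 2 μ = (∫⁻ x, ENNReal.ofReal (f x ^ 2) ∂μ) ^ (1 / 2 : ℝ) := by
  rw [← eLpNorm_two_sq_eq_lintegral, ← ENNReal.rpow_natCast, ← ENNReal.rpow_mul]
  norm_num

end Seminorm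

/-! ### The rectangle seminorm is `L²(γ)`-bounded -/

section Bounded

variable {E : Type*} [NormedAddCommGroup E] [InnerProductSpace ℝ E] [FiniteDimensional ℝ E]
  [MeasurableSpace E] [BorelSpace E]

/-- Marginals of the rectangle measure: a function of `(c, z)` only. [folklore] -/
theorem lintegral_rectMeasure_fst_fst {h : ℝ → E → ℝ≥0∞} (hh : Measurable (Function.uncurry h)) :
    ∫⁻ q, h q.1.1 q.2.1 ∂(((gaussianReal 0 1).prod (gaussianReal 0 1)).prod ((stdGaussian E).prod (stdGaussian E))) =
      ∫⁻ z, ∫⁻ c, h c z ∂gaussianReal 0 1 ∂stdGaussian E := by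
  rw [lintegral_rectMeasure_eq (G := fun q : (ℝ × ℝ) × (E × E) => h q.1.1 q.2.1)
    (hh.comp (by fun_prop : Measurable fun q : (ℝ × ℝ) × (E × E) => (q.1.1, q.2.1)))]
  simp only [lintegral_const, measure_univ, mul_one]

/-- Marginals of the rectangle measure: a function of `(s, z)` only. [folklore] -/
theorem lintegral_rectMeasure_snd_fst {h : ℝ → E → ℝ≥0∞} (hh : Measurable (Function.uncurry h)) :
    ∫⁻ q, h q.1.2 q.2.1 ∂(((gaussianReal 0 1).prod (gaussianReal 0 1)).prod ((stdGaussian E).prod (stdGaussian E))) =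
      ∫⁻ z, ∫⁻ c, h c z ∂gaussianReal 0 1 ∂stdGaussian E := by
  rw [lintegral_rectMeasure_eq (G := fun q : (ℝ × ℝ) × (E × E) => h q.1.2 q.2.1)
    (hh.comp (by fun_prop : Measurable fun q : (ℝ × ℝ) × (E × E) => (q.1.2, q.2.1)))]
  simp only [lintegral_const, measure_univ, mul_one]

/-- Marginals of the rectangle measure: a function of `(c, z_*)` only. [folklore] -/
theorem lintegral_rectMeasure_fst_snd {h : ℝ → E → ℝ≥0∞} (hh : Measurable (Function.uncurry h)) :
    ∫⁻ q, h q.1.1 q.2.2 ∂(((gaussianReal 0 1).prod (gaussianReal 0 1)).prod ((stdGaussian E).prod (stdGaussian E))) =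
      ∫⁻ z, ∫⁻ c, h c z ∂gaussianReal 0 1 ∂stdGaussian E := by
  rw [lintegral_rectMeasure_eq (G := fun q : (ℝ × ℝ) × (E × E) => h q.1.1 q.2.2)
    (hh.comp (by fun_prop : Measurable fun q : (ℝ × ℝ) × (E × E) => (q.1.1, q.2.2)))]
  simp only [lintegral_const, measure_univ, mul_one]

/-- Marginals of the rectangle measure: a function of `(s, z_*)` only. [folklore] -/
theorem lintegral_rectMeasure_snd_snd {h : ℝ → E → ℝ≥0∞} (hh : Measurable (Function.uncurry h)) :
    ∫⁻ q, h q.1.2 q.2.2 ∂(((gaussianReal 0 1).prod (gaussianReal 0 1)).prod ((stdGaussian E).prod (stdGaussian E))) =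
      ∫⁻ z, ∫⁻ c, h c z ∂gaussianReal 0 1 ∂stdGaussian E := by
  rw [lintegral_rectMeasure_eq (G := fun q : (ℝ × ℝ) × (E × E) => h q.1.2 q.2.2)
    (hh.comp (by fun_prop : Measurable fun q : (ℝ × ℝ) × (E × E) => (q.1.2, q.2.2)))]
  simp only [lintegral_const, measure_univ, mul_one]

/-- Corner `0` of the rectangle has `L²(σ⊗(((gaussianReal 0 1).prod (gaussianReal 0 1)).prod ((stdGaussian E).prod (stdGaussian E))))`-norm `σ(S)^{1/2} ‖f‖_{L²(γ)}`. [folklore] -/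
theorem eLpNorm_corner0 {f : E → ℝ} (hf : Continuous f) :
    eLpNorm (fun x : sphere (0 : E) 1 × ((ℝ × ℝ) × (E × E)) =>
        f (x.2.1.1 • (x.1 : E) + (x.2.2.1 - ⟪x.2.2.1, (x.1 : E)⟫_ℝ • (x.1 : E)))) 2
        ((sphereMeasure : Measure (sphere (0 : E) 1)).prod
          (((gaussianReal 0 1).prod (gaussianReal 0 1)).prod ((stdGaussian E).prod (stdGaussian E)))) =
      sphereMeasure (univ : Set (sphere (0 : E) 1)) ^ (1 / 2 : ℝ) * eLpNorm f 2 (stdGaussian E) := by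
  haveI := isFiniteMeasure_sphereMeasure (E := E)
  rw [eLpNorm_two_eq_rpow, eLpNorm_two_eq_rpow, ← ENNReal.mul_rpow_of_nonneg _ _ (by norm_num)]
  congr 1
  have hm : Measurable fun x : sphere (0 : E) 1 × ((ℝ × ℝ) × (E × E)) =>
      ENNReal.ofReal (f (x.2.1.1 • (x.1 : E) + (x.2.2.1 - ⟪x.2.2.1, (x.1 : E)⟫_ℝ • (x.1 : E))) ^ 2) :=
    (Continuous.measurable (by fun_prop)).ennreal_ofReal
  rw [lintegral_prod (fun x : sphere (0 : E) 1 × ((ℝ × ℝ) × (E × E)) =>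
      ENNReal.ofReal (f (x.2.1.1 • (x.1 : E) + (x.2.2.1 - ⟪x.2.2.1, (x.1 : E)⟫_ℝ • (x.1 : E))) ^ 2))
    hm.aemeasurable]
  have hinner : ∀ ω : sphere (0 : E) 1, ∫⁻ q : (ℝ × ℝ) × (E × E), ENNReal.ofReal
      (f (q.1.1 • (ω : E) + (q.2.1 - ⟪q.2.1, (ω : E)⟫_ℝ • (ω : E))) ^ 2)
        ∂(((gaussianReal 0 1).prod (gaussianReal 0 1)).prod ((stdGaussian E).prod (stdGaussian E))) =
      ∫⁻ v, ENNReal.ofReal (f v ^ 2) ∂stdGaussian E := by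
    intro ω
    have hω : ‖(ω : E)‖ = 1 := norm_eq_of_mem_sphere ω
    have hhm : Measurable (Function.uncurry fun (c : ℝ) (z : E) =>
        ENNReal.ofReal (f (c • (ω : E) + (z - ⟪z, (ω : E)⟫_ℝ • (ω : E))) ^ 2)) := by
      simp only [Function.uncurry_def]
      exact (Continuous.measurable (by fun_prop)).ennreal_ofReal
    rw [lintegral_stdGaussian_fibre_symm hω
      (show Measurable fun v : E => ENNReal.ofReal (f v ^ 2) from (Continuous.measurable (by fun_prop)).ennreal_ofReal)]
    exact lintegral_rectMeasure_fst_fst hhm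
  simp_rw [hinner]
  rw [lintegral_const, mul_comm]

/-- Corner `1` of the rectangle has `L²(σ⊗(((gaussianReal 0 1).prod (gaussianReal 0 1)).prod ((stdGaussian E).prod (stdGaussian E))))`-norm `σ(S)^{1/2} ‖f‖_{L²(γ)}`. [folklore] -/
theorem eLpNorm_corner1 {f : E → ℝ} (hf : Continuous f) :
    eLpNorm (fun x : sphere (0 : E) 1 × ((ℝ × ℝ) × (E × E)) =>
        f (x.2.1.2 • (x.1 : E) + (x.2.2.1 - ⟪x.2.2.1, (x.1 : E)⟫_ℝ • (x.1 : E)))) 2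
        ((sphereMeasure : Measure (sphere (0 : E) 1)).prod
          (((gaussianReal 0 1).prod (gaussianReal 0 1)).prod ((stdGaussian E).prod (stdGaussian E)))) =
      sphereMeasure (univ : Set (sphere (0 : E) 1)) ^ (1 / 2 : ℝ) * eLpNorm f 2 (stdGaussian E) := by
  haveI := isFiniteMeasure_sphereMeasure (E := E)
  rw [eLpNorm_two_eq_rpow, eLpNorm_two_eq_rpow, ← ENNReal.mul_rpow_of_nonneg _ _ (by norm_num)]
  congr 1
  have hm : Measurable fun x : sphere (0 : E) 1 × ((ℝ × ℝ) × (E × E)) =>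
      ENNReal.ofReal (f (x.2.1.2 • (x.1 : E) + (x.2.2.1 - ⟪x.2.2.1, (x.1 : E)⟫_ℝ • (x.1 : E))) ^ 2) :=
    (Continuous.measurable (by fun_prop)).ennreal_ofReal
  rw [lintegral_prod (fun x : sphere (0 : E) 1 × ((ℝ × ℝ) × (E × E)) =>
      ENNReal.ofReal (f (x.2.1.2 • (x.1 : E) + (x.2.2.1 - ⟪x.2.2.1, (x.1 : E)⟫_ℝ • (x.1 : E))) ^ 2))
    hm.aemeasurable]
  have hinner : ∀ ω : sphere (0 : E) 1, ∫⁻ q : (ℝ × ℝ) × (E × E), ENNReal.ofReal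
      (f (q.1.2 • (ω : E) + (q.2.1 - ⟪q.2.1, (ω : E)⟫_ℝ • (ω : E))) ^ 2)
        ∂(((gaussianReal 0 1).prod (gaussianReal 0 1)).prod ((stdGaussian E).prod (stdGaussian E))) =
      ∫⁻ v, ENNReal.ofReal (f v ^ 2) ∂stdGaussian E := by
    intro ω
    have hω : ‖(ω : E)‖ = 1 := norm_eq_of_mem_sphere ω
    have hhm : Measurable (Function.uncurry fun (c : ℝ) (z : E) =>
        ENNReal.ofReal (f (c • (ω : E) + (z - ⟪z, (ω : E)⟫_ℝ • (ω : E))) ^ 2)) := by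
      simp only [Function.uncurry_def]
      exact (Continuous.measurable (by fun_prop)).ennreal_ofReal
    rw [lintegral_stdGaussian_fibre_symm hω
      (show Measurable fun v : E => ENNReal.ofReal (f v ^ 2) from (Continuous.measurable (by fun_prop)).ennreal_ofReal)]
    exact lintegral_rectMeasure_snd_fst hhm
  simp_rw [hinner]
  rw [lintegral_const, mul_comm]

/-- Corner `2` of the rectangle has `L²(σ⊗(((gaussianReal 0 1).prod (gaussianReal 0 1)).prod ((stdGaussian E).prod (stdGaussian E))))`-norm `σ(S)^{1/2} ‖f‖_{L²(γ)}`. [folklore] -/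
theorem eLpNorm_corner2 {f : E → ℝ} (hf : Continuous f) :
    eLpNorm (fun x : sphere (0 : E) 1 × ((ℝ × ℝ) × (E × E)) =>
        f (x.2.1.1 • (x.1 : E) + (x.2.2.2 - ⟪x.2.2.2, (x.1 : E)⟫_ℝ • (x.1 : E)))) 2
        ((sphereMeasure : Measure (sphere (0 : E) 1)).prod
          (((gaussianReal 0 1).prod (gaussianReal 0 1)).prod ((stdGaussian E).prod (stdGaussian E)))) =
      sphereMeasure (univ : Set (sphere (0 : E) 1)) ^ (1 / 2 : ℝ) * eLpNorm f 2 (stdGaussian E) := by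
  haveI := isFiniteMeasure_sphereMeasure (E := E)
  rw [eLpNorm_two_eq_rpow, eLpNorm_two_eq_rpow, ← ENNReal.mul_rpow_of_nonneg _ _ (by norm_num)]
  congr 1
  have hm : Measurable fun x : sphere (0 : E) 1 × ((ℝ × ℝ) × (E × E)) =>
      ENNReal.ofReal (f (x.2.1.1 • (x.1 : E) + (x.2.2.2 - ⟪x.2.2.2, (x.1 : E)⟫_ℝ • (x.1 : E))) ^ 2) :=
    (Continuous.measurable (by fun_prop)).ennreal_ofReal
  rw [lintegral_prod (fun x : sphere (0 : E) 1 × ((ℝ × ℝ) × (E × E)) =>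
      ENNReal.ofReal (f (x.2.1.1 • (x.1 : E) + (x.2.2.2 - ⟪x.2.2.2, (x.1 : E)⟫_ℝ • (x.1 : E))) ^ 2))
    hm.aemeasurable]
  have hinner : ∀ ω : sphere (0 : E) 1, ∫⁻ q : (ℝ × ℝ) × (E × E), ENNReal.ofReal
      (f (q.1.1 • (ω : E) + (q.2.2 - ⟪q.2.2, (ω : E)⟫_ℝ • (ω : E))) ^ 2)
        ∂(((gaussianReal 0 1).prod (gaussianReal 0 1)).prod ((stdGaussian E).prod (stdGaussian E))) =
      ∫⁻ v, ENNReal.ofReal (f v ^ 2) ∂stdGaussian E := by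
    intro ω
    have hω : ‖(ω : E)‖ = 1 := norm_eq_of_mem_sphere ω
    have hhm : Measurable (Function.uncurry fun (c : ℝ) (z : E) =>
        ENNReal.ofReal (f (c • (ω : E) + (z - ⟪z, (ω : E)⟫_ℝ • (ω : E))) ^ 2)) := by
      simp only [Function.uncurry_def]
      exact (Continuous.measurable (by fun_prop)).ennreal_ofReal
    rw [lintegral_stdGaussian_fibre_symm hω
      (show Measurable fun v : E => ENNReal.ofReal (f v ^ 2) from (Continuous.measurable (by fun_prop)).ennreal_ofReal)]
    exact lintegral_rectMeasure_fst_snd hhm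
  simp_rw [hinner]
  rw [lintegral_const, mul_comm]

/-- Corner `3` of the rectangle has `L²(σ⊗(((gaussianReal 0 1).prod (gaussianReal 0 1)).prod ((stdGaussian E).prod (stdGaussian E))))`-norm `σ(S)^{1/2} ‖f‖_{L²(γ)}`. [folklore] -/
theorem eLpNorm_corner3 {f : E → ℝ} (hf : Continuous f) :
    eLpNorm (fun x : sphere (0 : E) 1 × ((ℝ × ℝ) × (E × E)) =>
        f (x.2.1.2 • (x.1 : E) + (x.2.2.2 - ⟪x.2.2.2, (x.1 : E)⟫_ℝ • (x.1 : E)))) 2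
        ((sphereMeasure : Measure (sphere (0 : E) 1)).prod
          (((gaussianReal 0 1).prod (gaussianReal 0 1)).prod ((stdGaussian E).prod (stdGaussian E)))) =
      sphereMeasure (univ : Set (sphere (0 : E) 1)) ^ (1 / 2 : ℝ) * eLpNorm f 2 (stdGaussian E) := by
  haveI := isFiniteMeasure_sphereMeasure (E := E)
  rw [eLpNorm_two_eq_rpow, eLpNorm_two_eq_rpow, ← ENNReal.mul_rpow_of_nonneg _ _ (by norm_num)]
  congr 1
  have hm : Measurable fun x : sphere (0 : E) 1 × ((ℝ × ℝ) × (E × E)) =>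
      ENNReal.ofReal (f (x.2.1.2 • (x.1 : E) + (x.2.2.2 - ⟪x.2.2.2, (x.1 : E)⟫_ℝ • (x.1 : E))) ^ 2) :=
    (Continuous.measurable (by fun_prop)).ennreal_ofReal
  rw [lintegral_prod (fun x : sphere (0 : E) 1 × ((ℝ × ℝ) × (E × E)) =>
      ENNReal.ofReal (f (x.2.1.2 • (x.1 : E) + (x.2.2.2 - ⟪x.2.2.2, (x.1 : E)⟫_ℝ • (x.1 : E))) ^ 2))
    hm.aemeasurable]
  have hinner : ∀ ω : sphere (0 : E) 1, ∫⁻ q : (ℝ × ℝ) × (E × E), ENNReal.ofReal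
      (f (q.1.2 • (ω : E) + (q.2.2 - ⟪q.2.2, (ω : E)⟫_ℝ • (ω : E))) ^ 2)
        ∂(((gaussianReal 0 1).prod (gaussianReal 0 1)).prod ((stdGaussian E).prod (stdGaussian E))) =
      ∫⁻ v, ENNReal.ofReal (f v ^ 2) ∂stdGaussian E := by
    intro ω
    have hω : ‖(ω : E)‖ = 1 := norm_eq_of_mem_sphere ω
    have hhm : Measurable (Function.uncurry fun (c : ℝ) (z : E) =>
        ENNReal.ofReal (f (c • (ω : E) + (z - ⟪z, (ω : E)⟫_ℝ • (ω : E))) ^ 2)) := by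
      simp only [Function.uncurry_def]
      exact (Continuous.measurable (by fun_prop)).ennreal_ofReal
    rw [lintegral_stdGaussian_fibre_symm hω
      (show Measurable fun v : E => ENNReal.ofReal (f v ^ 2) from (Continuous.measurable (by fun_prop)).ennreal_ofReal)]
    exact lintegral_rectMeasure_snd_snd hhm
  simp_rw [hinner]
  rw [lintegral_const, mul_comm]

/-- **The rectangle seminorm is `L²(γ)`-bounded**: for continuous `f`,
`‖(ω, q) ↦ R_ω f (q)‖_{L²(σ⊗(((gaussianReal 0 1).prod (gaussianReal 0 1)).prod ((stdGaussian E).prod (stdGaussian E))))} ≤ 4 σ(S)^{1/2} ‖f‖_{L²(γ)}`. [folklore] -/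
theorem eLpNorm_rectIncr_le {f : E → ℝ} (hf : Continuous f) :
    eLpNorm (fun x : sphere (0 : E) 1 × ((ℝ × ℝ) × (E × E)) => rectIncr (x.1 : E) f x.2) 2
        ((sphereMeasure : Measure (sphere (0 : E) 1)).prod
          (((gaussianReal 0 1).prod (gaussianReal 0 1)).prod ((stdGaussian E).prod (stdGaussian E)))) ≤
      4 * sphereMeasure (univ : Set (sphere (0 : E) 1)) ^ (1 / 2 : ℝ) * eLpNorm f 2 (stdGaussian E) := by
  set ν := (sphereMeasure : Measure (sphere (0 : E) 1)).prod
    (((gaussianReal 0 1).prod (gaussianReal 0 1)).prod ((stdGaussian E).prod (stdGaussian E))) with hν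
  set F0 : sphere (0 : E) 1 × ((ℝ × ℝ) × (E × E)) → ℝ := fun x =>
    f (x.2.1.1 • (x.1 : E) + (x.2.2.1 - ⟪x.2.2.1, (x.1 : E)⟫_ℝ • (x.1 : E))) with hF0
  set F1 : sphere (0 : E) 1 × ((ℝ × ℝ) × (E × E)) → ℝ := fun x =>
    f (x.2.1.2 • (x.1 : E) + (x.2.2.1 - ⟪x.2.2.1, (x.1 : E)⟫_ℝ • (x.1 : E))) with hF1
  set F2 : sphere (0 : E) 1 × ((ℝ × ℝ) × (E × E)) → ℝ := fun x =>
    f (x.2.1.1 • (x.1 : E) + (x.2.2.2 - ⟪x.2.2.2, (x.1 : E)⟫_ℝ • (x.1 : E))) with hF2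
  set F3 : sphere (0 : E) 1 × ((ℝ × ℝ) × (E × E)) → ℝ := fun x =>
    f (x.2.1.2 • (x.1 : E) + (x.2.2.2 - ⟪x.2.2.2, (x.1 : E)⟫_ℝ • (x.1 : E))) with hF3
  have h0 : eLpNorm F0 2 ν = sphereMeasure (univ : Set (sphere (0 : E) 1)) ^ (1 / 2 : ℝ) * eLpNorm f 2 (stdGaussian E) :=
    eLpNorm_corner0 hf
  have h1 : eLpNorm F1 2 ν = sphereMeasure (univ : Set (sphere (0 : E) 1)) ^ (1 / 2 : ℝ) * eLpNorm f 2 (stdGaussian E) :=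
    eLpNorm_corner1 hf
  have h2 : eLpNorm F2 2 ν = sphereMeasure (univ : Set (sphere (0 : E) 1)) ^ (1 / 2 : ℝ) * eLpNorm f 2 (stdGaussian E) :=
    eLpNorm_corner2 hf
  have h3 : eLpNorm F3 2 ν = sphereMeasure (univ : Set (sphere (0 : E) 1)) ^ (1 / 2 : ℝ) * eLpNorm f 2 (stdGaussian E) :=
    eLpNorm_corner3 hf
  have hm0 : AEStronglyMeasurable F0 ν := Continuous.aestronglyMeasurable (by rw [hF0]; fun_prop)
  have hm1 : AEStronglyMeasurable F1 ν := Continuous.aestronglyMeasurable (by rw [hF1]; fun_prop)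
  have hm2 : AEStronglyMeasurable F2 ν := Continuous.aestronglyMeasurable (by rw [hF2]; fun_prop)
  have hm3 : AEStronglyMeasurable F3 ν := Continuous.aestronglyMeasurable (by rw [hF3]; fun_prop)
  have hR : (fun x : sphere (0 : E) 1 × ((ℝ × ℝ) × (E × E)) => rectIncr (x.1 : E) f x.2) =
      F0 - F1 - F2 + F3 := by
    funext x
    simp only [hF0, hF1, hF2, hF3, rectIncr, Pi.add_apply, Pi.sub_apply]
  rw [hR]
  calc eLpNorm (F0 - F1 - F2 + F3) 2 ν
      ≤ eLpNorm (F0 - F1 - F2) 2 ν + eLpNorm F3 2 ν :=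
        eLpNorm_add_le ((hm0.sub hm1).sub hm2) hm3 one_le_two
    _ ≤ eLpNorm (F0 - F1) 2 ν + eLpNorm F2 2 ν + eLpNorm F3 2 ν := by
        gcongr
        exact eLpNorm_sub_le (hm0.sub hm1) hm2 one_le_two
    _ ≤ eLpNorm F0 2 ν + eLpNorm F1 2 ν + eLpNorm F2 2 ν + eLpNorm F3 2 ν := by
        gcongr
        exact eLpNorm_sub_le hm0 hm1 one_le_two
    _ = 4 * sphereMeasure (univ : Set (sphere (0 : E) 1)) ^ (1 / 2 : ℝ) * eLpNorm f 2 (stdGaussian E) := by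
        rw [h0, h1, h2, h3]
        ring

/-- The rectangle seminorm squared is the sphere-averaged rectangle form `Q`. [folklore] -/
theorem eLpNorm_rectIncr_sq {f : E → ℝ} (hf : Continuous f) :
    eLpNorm (fun x : sphere (0 : E) 1 × ((ℝ × ℝ) × (E × E)) => rectIncr (x.1 : E) f x.2) 2
        ((sphereMeasure : Measure (sphere (0 : E) 1)).prod
          (((gaussianReal 0 1).prod (gaussianReal 0 1)).prod ((stdGaussian E).prod (stdGaussian E)))) ^ 2 =
      ∫⁻ ω, ∫⁻ q, ENNReal.ofReal (rectIncr (ω : E) f q ^ 2)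
        ∂(((gaussianReal 0 1).prod (gaussianReal 0 1)).prod ((stdGaussian E).prod (stdGaussian E)))
        ∂(sphereMeasure : Measure (sphere (0 : E) 1)) := by
  haveI := isFiniteMeasure_sphereMeasure (E := E)
  rw [eLpNorm_two_sq_eq_lintegral]
  have hc : Continuous fun x : sphere (0 : E) 1 × ((ℝ × ℝ) × (E × E)) => rectIncr (x.1 : E) f x.2 := by
    unfold rectIncr; fun_prop
  exact lintegral_prod (fun x : sphere (0 : E) 1 × ((ℝ × ℝ) × (E × E)) => ENNReal.ofReal (rectIncr (x.1 : E) f x.2 ^ 2))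
    (show Measurable fun x : sphere (0 : E) 1 × ((ℝ × ℝ) × (E × E)) => ENNReal.ofReal (rectIncr (x.1 : E) f x.2 ^ 2)
      from (Continuous.measurable (hc.pow 2)).ennreal_ofReal).aemeasurable

omit [FiniteDimensional ℝ E] [MeasurableSpace E] [BorelSpace E] in
/-- The rectangle increment is additive in the function. [folklore] -/
theorem rectIncr_add (ω : E) (f g : E → ℝ) (q : (ℝ × ℝ) × (E × E)) :
    rectIncr ω (f + g) q = rectIncr ω f q + rectIncr ω g q := by
  simp only [rectIncr, Pi.add_apply]; ring

omit [FiniteDimensional ℝ E] [MeasurableSpace E] [BorelSpace E] in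
/-- The rectangle increment is compatible with subtraction. [folklore] -/
theorem rectIncr_sub (ω : E) (f g : E → ℝ) (q : (ℝ × ℝ) × (E × E)) :
    rectIncr ω (f - g) q = rectIncr ω f q - rectIncr ω g q := by
  simp only [rectIncr, Pi.sub_apply]; ring

end Bounded

/-! ### Correcting a polynomial inside the collision invariants -/

section Invariants

variable {ι : Type*} [Fintype ι] [DecidableEq ι]

/-- A multi-index of degree one is a unit vector `eᵢ`. [folklore] -/
theorem eq_single_of_degree_eq_one {α : ι →₀ ℕ} (h : α.degree = 1) : ∃ i, α = Finsupp.single i 1 := by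
  rw [Finsupp.degree_eq_sum] at h
  have hne : α.support.Nonempty := by
    by_contra h0
    rw [Finset.not_nonempty_iff_eq_empty, Finsupp.support_eq_empty] at h0
    rw [h0] at h
    simp at h
  obtain ⟨i, hi⟩ := hne
  have hαi : 1 ≤ α i := Nat.one_le_iff_ne_zero.2 (Finsupp.mem_support_iff.1 hi)
  have hsplit := Finset.add_sum_erase Finset.univ (fun j => α j) (Finset.mem_univ i)
  have hle : α i ≤ ∑ j, α j := Finset.single_le_sum (fun j _ => Nat.zero_le (α j)) (Finset.mem_univ i)
  have hrest : ∑ j ∈ Finset.univ.erase i, α j = 0 := by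
    omega
  refine ⟨i, Finsupp.ext fun j => ?_⟩
  by_cases hj : j = i
  · subst hj
    rw [Finsupp.single_eq_same]
    omega
  · rw [Finsupp.single_apply, if_neg (Ne.symm hj)]
    exact Finset.sum_eq_zero_iff.1 hrest j (Finset.mem_erase.2 ⟨hj, Finset.mem_univ j⟩)

/-- If all linear coefficients vanish, the degree-one component vanishes. [folklore] -/
theorem homogeneousComponent_one_eq_zero {p : MvPolynomial ι ℝ}
    (h : ∀ i, MvPolynomial.coeff (Finsupp.single i 1) p = 0) : MvPolynomial.homogeneousComponent 1 p = 0 := by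
  ext α
  rw [MvPolynomial.coeff_homogeneousComponent, MvPolynomial.coeff_zero]
  split_ifs with hα
  · obtain ⟨i, rfl⟩ := eq_single_of_degree_eq_one hα
    exact h i
  · rfl

/-- The Laplacian of the quadratic component is the constant `2 Σⱼ p_{2eⱼ}`. [folklore] -/
theorem laplacian_homogeneousComponent_two (p : MvPolynomial ι ℝ) :
    ∑ j, MvPolynomial.pderiv j (MvPolynomial.pderiv j (MvPolynomial.homogeneousComponent 2 p)) =
      MvPolynomial.C (2 * ∑ j, MvPolynomial.coeff (Finsupp.single j 2) p) := by
  ext α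
  rw [MvPolynomial.coeff_sum, MvPolynomial.coeff_C]
  have hterm : ∀ j, MvPolynomial.coeff α (MvPolynomial.pderiv j (MvPolynomial.pderiv j
      (MvPolynomial.homogeneousComponent 2 p))) =
      if α = 0 then 2 * MvPolynomial.coeff (Finsupp.single j 2) p else 0 := by
    intro j
    rw [MvPolynomial.coeff_pderiv, MvPolynomial.coeff_pderiv, MvPolynomial.coeff_homogeneousComponent,
      add_assoc, ← Finsupp.single_add, Finsupp.add_apply, Finsupp.single_eq_same]
    have hdeg : (α + Finsupp.single j (1 + 1)).degree = α.degree + 2 := by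
      rw [map_add, Finsupp.degree_single]
    rw [hdeg]
    by_cases h0 : α = 0
    · subst h0
      simp only [map_zero, zero_add, if_true, Finsupp.coe_zero, Pi.zero_apply]
      push_cast
      ring
    · have hd : α.degree ≠ 0 := by
        intro hd
        exact h0 ((Finsupp.degree_eq_zero_iff α).1 hd)
      rw [if_neg (by omega), if_neg h0]
      ring
  simp_rw [hterm]
  by_cases h0 : α = 0
  · subst h0
    simp [Finset.mul_sum]
  · simp [h0, Ne.symm h0]

/-- The fluid modes `1, Xᵢ, Σⱼ Xⱼ²` in Fischer space: inner products with a polynomial. [folklore] -/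
theorem fischerInner_fluid (p : MvPolynomial ι ℝ) :
    fischerInner (1 : MvPolynomial ι ℝ) p = MvPolynomial.coeff 0 p ∧
    (∀ i, fischerInner (MvPolynomial.X i : MvPolynomial ι ℝ) p = MvPolynomial.coeff (Finsupp.single i 1) p) ∧
    fischerInner (∑ j, MvPolynomial.X j ^ 2 : MvPolynomial ι ℝ) p =
      2 * ∑ j, MvPolynomial.coeff (Finsupp.single j 2) p := by
  refine ⟨?_, fun i => ?_, ?_⟩
  · rw [show (1 : MvPolynomial ι ℝ) = MvPolynomial.monomial 0 1 from rfl, fischerInner_monomial_one_left]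
    simp [mfactorial]
  · rw [show (MvPolynomial.X i : MvPolynomial ι ℝ) = MvPolynomial.monomial (Finsupp.single i 1) 1 from rfl,
      fischerInner_monomial_one_left, mfactorial_single_one, one_mul]
  · rw [fischerInner_sum_left, Finset.mul_sum]
    refine Finset.sum_congr rfl fun j _ => ?_
    rw [show (MvPolynomial.X j ^ 2 : MvPolynomial ι ℝ) = MvPolynomial.monomial (Finsupp.single j 2) 1 by
      rw [MvPolynomial.X_pow_eq_monomial], fischerInner_monomial_one_left]
    congr 1
    unfold mfactorial
    rw [Finset.prod_eq_single j]
    · simp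
    · intro i _ hi; simp [Ne.symm hi]
    · simp

/-- **Gap hypotheses from orthogonality to the fluid modes**: if `p ⊥_F 1`, `p ⊥_F Xᵢ` for all `i`
and `p ⊥_F Σⱼ Xⱼ²`, then `p₀ = 0`, `p₁ = 0` and `Δ p₂ = 0`. [folklore] -/
theorem gap_hypotheses_of_orthogonal {p : MvPolynomial ι ℝ}
    (h0 : fischerInner (1 : MvPolynomial ι ℝ) p = 0)
    (h1 : ∀ i, fischerInner (MvPolynomial.X i : MvPolynomial ι ℝ) p = 0)
    (h2 : fischerInner (∑ j, MvPolynomial.X j ^ 2 : MvPolynomial ι ℝ) p = 0) :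
    MvPolynomial.homogeneousComponent 0 p = 0 ∧ MvPolynomial.homogeneousComponent 1 p = 0 ∧
      ∑ j, MvPolynomial.pderiv j (MvPolynomial.pderiv j (MvPolynomial.homogeneousComponent 2 p)) = 0 := by
  obtain ⟨e0, e1, e2⟩ := fischerInner_fluid p
  refine ⟨?_, ?_, ?_⟩
  · rw [MvPolynomial.homogeneousComponent_zero, ← e0, h0, MvPolynomial.C_0]
  · exact homogeneousComponent_one_eq_zero fun i => by rw [← e1 i, h1 i]
  · rw [laplacian_homogeneousComponent_two, ← e2, h2, MvPolynomial.C_0]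

end Invariants

/-! ### The fluid modes as Wick polynomials and the corrected approximation -/

section Approx

variable {E : Type*} [NormedAddCommGroup E] [InnerProductSpace ℝ E] [FiniteDimensional ℝ E]
  [MeasurableSpace E] [BorelSpace E]
variable {ι : Type*} [Fintype ι] [DecidableEq ι]

omit [FiniteDimensional ℝ E] [MeasurableSpace E] [BorelSpace E] in
/-- `𝓗_b 1 = 1`. [folklore] -/
theorem hermiteEval_one (b : OrthonormalBasis ι ℝ E) (v : E) : hermiteEval b (1 : MvPolynomial ι ℝ) v = 1 := by
  rw [show (1 : MvPolynomial ι ℝ) = MvPolynomial.monomial 0 1 from rfl, hermiteEval_monomial, hermiteProd_zero,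
    mul_one]

omit [FiniteDimensional ℝ E] [MeasurableSpace E] [BorelSpace E] in
/-- `𝓗_b (Σⱼ Xⱼ²) = ‖v‖² - d`. [folklore] -/
theorem hermiteEval_sum_X_sq (b : OrthonormalBasis ι ℝ E) (v : E) :
    hermiteEval b (∑ j, MvPolynomial.X j ^ 2 : MvPolynomial ι ℝ) v = ‖v‖ ^ 2 - Fintype.card ι := by
  rw [hermiteEval_sum, norm_sq_eq_sum_coord_sq b v]
  have h : ∀ j, hermiteEval b (MvPolynomial.X j ^ 2 : MvPolynomial ι ℝ) v = ⟪b j, v⟫_ℝ * ⟪b j, v⟫_ℝ - 1 := by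
    intro j
    rw [coord_mul_coord_eq_hermiteEval b j j v, if_pos rfl, sq]
    ring
  simp_rw [h]
  rw [Finset.sum_sub_distrib]
  simp

omit [FiniteDimensional ℝ E] [MeasurableSpace E] [BorelSpace E] in
/-- The fluid Wick polynomials lie in the collision invariants. [folklore] -/
theorem hermiteEval_fluid_mem_collisionInvariants (b : OrthonormalBasis ι ℝ E) :
    hermiteEval b (1 : MvPolynomial ι ℝ) ∈ collisionInvariants E ∧
    (∀ i, hermiteEval b (MvPolynomial.X i : MvPolynomial ι ℝ) ∈ collisionInvariants E) ∧
    hermiteEval b (∑ j, MvPolynomial.X j ^ 2 : MvPolynomial ι ℝ) ∈ collisionInvariants E := by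
  have m1 : (fun _ : E => (1 : ℝ)) ∈ collisionInvariants E :=
    Submodule.subset_span (Or.inl (Or.inl rfl))
  have m2 : (fun v : E => ‖v‖ ^ 2) ∈ collisionInvariants E :=
    Submodule.subset_span (Or.inl (Or.inr rfl))
  have m3 : ∀ e : E, (fun v : E => ⟪v, e⟫_ℝ) ∈ collisionInvariants E := fun e =>
    Submodule.subset_span (Or.inr ⟨e, rfl⟩)
  refine ⟨?_, fun i => ?_, ?_⟩
  · have : hermiteEval b (1 : MvPolynomial ι ℝ) = fun _ : E => (1 : ℝ) := funext (hermiteEval_one b)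
    rw [this]; exact m1
  · have : hermiteEval b (MvPolynomial.X i : MvPolynomial ι ℝ) = fun v : E => ⟪v, b i⟫_ℝ := by
      funext v; rw [← coord_eq_hermiteEval_X, real_inner_comm]
    rw [this]; exact m3 (b i)
  · have : hermiteEval b (∑ j, MvPolynomial.X j ^ 2 : MvPolynomial ι ℝ) =
        (fun v : E => ‖v‖ ^ 2) - (Fintype.card ι : ℝ) • fun _ : E => (1 : ℝ) := by
      funext v; rw [hermiteEval_sum_X_sq]; simp
    rw [this]
    exact Submodule.sub_mem _ m2 (Submodule.smul_mem _ _ m1)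

/-- Squared Fischer norms of the fluid modes: `‖1‖² = 1`, `‖Xᵢ‖² = 1`, `‖Σⱼ Xⱼ²‖² = 2d`, and the
modes are pairwise Fischer-orthogonal. [folklore] -/
theorem fischerInner_fluid_gram :
    fischerInner (1 : MvPolynomial ι ℝ) 1 = 1 ∧
    (∀ i, fischerInner (MvPolynomial.X i : MvPolynomial ι ℝ) (MvPolynomial.X i) = 1) ∧
    fischerInner (∑ j, MvPolynomial.X j ^ 2 : MvPolynomial ι ℝ) (∑ j, MvPolynomial.X j ^ 2) =
      2 * Fintype.card ι ∧
    (∀ i, fischerInner (1 : MvPolynomial ι ℝ) (MvPolynomial.X i) = 0) ∧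
    fischerInner (1 : MvPolynomial ι ℝ) (∑ j, MvPolynomial.X j ^ 2) = 0 ∧
    (∀ i, fischerInner (MvPolynomial.X i : MvPolynomial ι ℝ) (∑ j, MvPolynomial.X j ^ 2) = 0) ∧
    (∀ i i', i ≠ i' → fischerInner (MvPolynomial.X i : MvPolynomial ι ℝ) (MvPolynomial.X i') = 0) := by
  have hc2 : ∀ (j : ι) (i : ι), MvPolynomial.coeff (Finsupp.single j 2) (MvPolynomial.X i : MvPolynomial ι ℝ) = 0 := by
    intro j i
    rw [MvPolynomial.coeff_X]
    rw [if_neg]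
    intro h
    have := Finsupp.single_eq_single_iff _ _ _ _ |>.1 h
    omega
  refine ⟨?_, fun i => ?_, ?_, fun i => ?_, ?_, fun i => ?_, fun i i' hii' => ?_⟩
  · rw [(fischerInner_fluid (1 : MvPolynomial ι ℝ)).1, MvPolynomial.coeff_one, if_pos rfl]
  · rw [(fischerInner_fluid (MvPolynomial.X i : MvPolynomial ι ℝ)).2.1 i, MvPolynomial.coeff_X, if_pos rfl]
  · rw [(fischerInner_fluid (∑ j, MvPolynomial.X j ^ 2 : MvPolynomial ι ℝ)).2.2]
    have : ∀ j : ι, MvPolynomial.coeff (Finsupp.single j 2) (∑ l, MvPolynomial.X l ^ 2 : MvPolynomial ι ℝ) = 1 := by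
      intro j
      rw [MvPolynomial.coeff_sum, Finset.sum_eq_single j]
      · rw [MvPolynomial.coeff_X_pow, if_pos rfl]
      · intro l _ hl
        rw [MvPolynomial.coeff_X_pow, if_neg]
        intro h
        exact hl ((Finsupp.single_left_injective (by norm_num)) h)
      · simp
    simp_rw [this]
    simp
  · rw [(fischerInner_fluid (MvPolynomial.X i : MvPolynomial ι ℝ)).1, MvPolynomial.coeff_zero_X]
  · rw [(fischerInner_fluid (∑ j, MvPolynomial.X j ^ 2 : MvPolynomial ι ℝ)).1, MvPolynomial.coeff_sum]
    refine Finset.sum_eq_zero fun j _ => ?_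
    rw [MvPolynomial.coeff_X_pow, if_neg]
    intro h
    have := congrArg (fun f : ι →₀ ℕ => f j) h
    simp at this
  · rw [(fischerInner_fluid (∑ j, MvPolynomial.X j ^ 2 : MvPolynomial ι ℝ)).2.1 i, MvPolynomial.coeff_sum]
    refine Finset.sum_eq_zero fun j _ => ?_
    rw [MvPolynomial.coeff_X_pow, if_neg]
    intro h
    have := Finsupp.single_eq_single_iff _ _ _ _ |>.1 h
    omega
  · rw [(fischerInner_fluid (MvPolynomial.X i' : MvPolynomial ι ℝ)).2.1 i, MvPolynomial.coeff_X, if_neg]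
    intro h
    exact hii' ((Finsupp.single_left_injective one_ne_zero) h).symm

/-- **Corrected polynomial approximation.** For `g ∈ L²(γ)` orthogonal (in `L²(γ)`) to the fluid Wick
polynomials `𝓗_b 1 = 1`, `𝓗_b Xᵢ = ⟪bᵢ, ·⟫`, `𝓗_b (Σ Xⱼ²) = ‖·‖² - d`, and `ε > 0`, there is a
polynomial `p` with `p₀ = 0`, `p₁ = 0`, `Δp₂ = 0` and `‖g - 𝓗_b p‖_{L²(γ)} < ε`. [folklore] -/
theorem exists_orthogonal_poly_approx [Nonempty ι] (b : OrthonormalBasis ι ℝ E) {g : E → ℝ}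
    (hg : MemLp g 2 (stdGaussian E))
    (horth0 : ∫ v, g v * hermiteEval b (1 : MvPolynomial ι ℝ) v ∂stdGaussian E = 0)
    (horth1 : ∀ i, ∫ v, g v * hermiteEval b (MvPolynomial.X i : MvPolynomial ι ℝ) v ∂stdGaussian E = 0)
    (horth2 : ∫ v, g v * hermiteEval b (∑ j, MvPolynomial.X j ^ 2 : MvPolynomial ι ℝ) v ∂stdGaussian E = 0)
    {ε : ℝ} (hε : 0 < ε) :
    ∃ p : MvPolynomial ι ℝ, MvPolynomial.homogeneousComponent 0 p = 0 ∧
      MvPolynomial.homogeneousComponent 1 p = 0 ∧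
      ∑ j, MvPolynomial.pderiv j (MvPolynomial.pderiv j (MvPolynomial.homogeneousComponent 2 p)) = 0 ∧
      eLpNorm (fun v => g v - hermiteEval b p v) 2 (stdGaussian E) < ENNReal.ofReal ε := by
  classical
  -- the fluid modes as a finite family `r k`, `k : Option (Option ι)`
  let r : Option (Option ι) → MvPolynomial ι ℝ := fun k => match k with
    | none => 1
    | some none => ∑ j, MvPolynomial.X j ^ 2
    | some (some i) => MvPolynomial.X i
  have hr0 : r none = 1 := rfl
  have hr2 : r (some none) = ∑ j, MvPolynomial.X j ^ 2 := rfl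
  have hr1 : ∀ i, r (some (some i)) = MvPolynomial.X i := fun i => rfl
  obtain ⟨g11, gXX, gSS, g1X, g1S, gXS, gXX'⟩ := fischerInner_fluid_gram (ι := ι)
  have hself : ∀ k, fischerInner (r k) (r k) ≠ 0 := by
    rintro (_ | _ | i)
    · rw [hr0, g11]; exact one_ne_zero
    · rw [hr2, gSS]
      have : (0 : ℝ) < Fintype.card ι := by exact_mod_cast Fintype.card_pos
      positivity
    · rw [hr1, gXX]; exact one_ne_zero
  have horthF : ∀ j k, j ≠ k → fischerInner (r j) (r k) = 0 := by
    rintro (_ | _ | i) (_ | _ | i') hjk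
    · exact absurd rfl hjk
    · rw [hr0, hr2, g1S]
    · rw [hr0, hr1, g1X]
    · rw [hr2, hr0, fischerInner_comm, g1S]
    · exact absurd rfl hjk
    · rw [hr2, hr1, fischerInner_comm, gXS]
    · rw [hr1, hr0, fischerInner_comm, g1X]
    · rw [hr1, hr2, gXS]
    · rw [hr1, hr1]
      exact gXX' i i' fun h => hjk (by rw [h])
  have horth : ∀ k, ∫ v, g v * hermiteEval b (r k) v ∂stdGaussian E = 0 := by
    rintro (_ | _ | i)
    · exact horth0
    · exact horth2
    · exact horth1 i
  -- the Hilbert space `H = L²(γ)`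
  set G : Lp ℝ 2 (stdGaussian E) := hg.toLp g with hG
  let e : Option (Option ι) → Lp ℝ 2 (stdGaussian E) := fun k => hermiteEvalLp b (r k)
  have hinner : ∀ (q : MvPolynomial ι ℝ) (k), ⟪e k, hermiteEvalLp b q⟫_ℝ = fischerInner (r k) q := by
    intro q k
    change ⟪hermiteEvalLp b (r k), hermiteEvalLp b q⟫_ℝ = _
    rw [MeasureTheory.L2.inner_def, ← integral_hermiteEval_mul_hermiteEval b (r k) q]
    refine integral_congr_ae ?_
    filter_upwards [MemLp.coeFn_toLp (memLp_two_hermiteEval b (r k)),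
      MemLp.coeFn_toLp (memLp_two_hermiteEval b q)] with v h1 h2
    change ⟪(hermiteEvalLp b (r k) : E → ℝ) v, (hermiteEvalLp b q : E → ℝ) v⟫_ℝ = _
    rw [show (hermiteEvalLp b (r k) : E → ℝ) v = hermiteEval b (r k) v from h1,
      show (hermiteEvalLp b q : E → ℝ) v = hermiteEval b q v from h2]
    simp only [RCLike.inner_apply, conj_trivial]
    ring
  have hGe : ∀ k, ⟪e k, G⟫_ℝ = 0 := by
    intro k
    change ⟪hermiteEvalLp b (r k), hg.toLp g⟫_ℝ = _
    rw [MeasureTheory.L2.inner_def, ← horth k]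
    refine integral_congr_ae ?_
    filter_upwards [MemLp.coeFn_toLp (memLp_two_hermiteEval b (r k)), MemLp.coeFn_toLp hg] with v h1 h2
    change ⟪(hermiteEvalLp b (r k) : E → ℝ) v, (hg.toLp g : E → ℝ) v⟫_ℝ = _
    rw [show (hermiteEvalLp b (r k) : E → ℝ) v = hermiteEval b (r k) v from h1, h2]
    simp only [RCLike.inner_apply, conj_trivial]
  have hnorm : ∀ q : MvPolynomial ι ℝ, ‖G - hermiteEvalLp b q‖ =
      (eLpNorm (fun v => g v - hermiteEval b q v) 2 (stdGaussian E)).toReal := by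
    intro q
    have hsub : G - hermiteEvalLp b q = (hg.sub (memLp_two_hermiteEval b q)).toLp (g - hermiteEval b q) := by
      rw [MemLp.toLp_sub hg (memLp_two_hermiteEval b q)]; rfl
    rw [hsub, Lp.norm_toLp]
    rfl
  have hne : ∀ q : MvPolynomial ι ℝ, eLpNorm (fun v => g v - hermiteEval b q v) 2 (stdGaussian E) ≠ ⊤ :=
    fun q => (hg.sub (memLp_two_hermiteEval b q)).eLpNorm_ne_top
  -- a raw polynomial approximation with accuracy `ε / K`
  set K : ℝ := 1 + Fintype.card (Option (Option ι)) with hK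
  have hK0 : 0 < K := by positivity
  obtain ⟨q, hq⟩ := exists_hermiteEval_sub_eLpNorm_lt b hg (div_pos hε hK0)
  have hq' : ‖G - hermiteEvalLp b q‖ < ε / K := by
    rw [hnorm]
    exact ENNReal.toReal_lt_of_lt_ofReal hq
  -- the corrected polynomial
  let c : Option (Option ι) → ℝ := fun k => fischerInner (r k) q / fischerInner (r k) (r k)
  set p : MvPolynomial ι ℝ := q - ∑ k, c k • r k with hp
  have hpk : ∀ k, fischerInner (r k) p = 0 := by
    intro k
    rw [hp, fischerInner_sub_right, fischerInner_sum_right, Finset.sum_eq_single k]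
    · rw [fischerInner_smul_right]
      change fischerInner (r k) q - fischerInner (r k) q / fischerInner (r k) (r k) * fischerInner (r k) (r k) = 0
      rw [div_mul_cancel₀ _ (hself k), sub_self]
    · intro j _ hj
      rw [fischerInner_smul_right, horthF k j (Ne.symm hj), mul_zero]
    · simp
  obtain ⟨hp0, hp1, hp2⟩ := gap_hypotheses_of_orthogonal (p := p) (hpk none) (fun i => hpk (some (some i)))
    (hpk (some none))
  refine ⟨p, hp0, hp1, hp2, ?_⟩
  -- the estimate in `H`
  have hcoef : ∀ k, |c k| * ‖e k‖ ≤ ‖G - hermiteEvalLp b q‖ := by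
    intro k
    have hek : ‖e k‖ ^ 2 = fischerInner (r k) (r k) := by
      rw [← real_inner_self_eq_norm_sq, hinner]
    have hek0 : ‖e k‖ ≠ 0 := by
      intro h0; apply hself k; rw [← hek, h0]; ring
    have hekpos : 0 < ‖e k‖ := lt_of_le_of_ne (norm_nonneg _) (Ne.symm hek0)
    have hnum : fischerInner (r k) q = ⟪e k, hermiteEvalLp b q - G⟫_ℝ := by
      rw [inner_sub_right, hinner, hGe, sub_zero]
    have hck : c k = ⟪e k, hermiteEvalLp b q - G⟫_ℝ / ‖e k‖ ^ 2 := by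
      change fischerInner (r k) q / fischerInner (r k) (r k) = _
      rw [hnum, hek]
    rw [hck, abs_div, abs_of_pos (by positivity : 0 < ‖e k‖ ^ 2), div_mul_eq_mul_div,
      div_le_iff₀ (by positivity)]
    calc |⟪e k, hermiteEvalLp b q - G⟫_ℝ| * ‖e k‖ ≤ ‖e k‖ * ‖hermiteEvalLp b q - G‖ * ‖e k‖ :=
          mul_le_mul_of_nonneg_right (abs_real_inner_le_norm _ _) (norm_nonneg _)
      _ = ‖G - hermiteEvalLp b q‖ * ‖e k‖ ^ 2 := by rw [norm_sub_rev]; ring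
  have hdecomp : G - hermiteEvalLp b p = (G - hermiteEvalLp b q) + ∑ k, c k • e k := by
    rw [hp, map_sub, map_sum]
    simp_rw [map_smul]
    abel
  have hest : ‖G - hermiteEvalLp b p‖ ≤ K * ‖G - hermiteEvalLp b q‖ := by
    rw [hdecomp]
    refine (norm_add_le _ _).trans ?_
    refine (add_le_add_right (norm_sum_le Finset.univ fun k => c k • e k) _).trans ?_
    have : ∀ k : Option (Option ι), k ∈ Finset.univ → ‖c k • e k‖ ≤ ‖G - hermiteEvalLp b q‖ := fun k _ => by
      rw [norm_smul, Real.norm_eq_abs]; exact hcoef k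
    refine (add_le_add_right (Finset.sum_le_sum this) _).trans ?_
    rw [Finset.sum_const, Finset.card_univ, nsmul_eq_mul, hK]
    ring_nf
    rfl
  have hfinal : ‖G - hermiteEvalLp b p‖ < ε := by
    calc ‖G - hermiteEvalLp b p‖ ≤ K * ‖G - hermiteEvalLp b q‖ := hest
      _ < K * (ε / K) := mul_lt_mul_of_pos_left hq' hK0
      _ = ε := mul_div_cancel₀ _ hK0.ne'
  rw [← ENNReal.ofReal_toReal (hne p), ← hnorm, ENNReal.ofReal_lt_ofReal_iff hε]
  exact hfinal

end Approx

/-! ### Extension of the polynomial gap to temperate functions -/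

section Extension

variable {E : Type*} [NormedAddCommGroup E] [InnerProductSpace ℝ E] [FiniteDimensional ℝ E]
  [MeasurableSpace E] [BorelSpace E]


/-- **The rectangle form dominates `κ_d ‖g‖²_{L²(γ)}`** for every temperate `g` orthogonal to the
collision invariants (`d ≥ 2`, `κ_d = 16 σ(S) (d-1)/(3d(d+2))`): extension of the polynomial gap
(`lintegral_sphere_rectForm_ge`) by density and the `L²`-boundedness of the rectangle seminorm. [folklore] -/
theorem kappa_mul_lintegral_sq_le_rectForm (hd2 : 2 ≤ finrank ℝ E) {g : E → ℝ} (hg : g.HasTemperateGrowth)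
    (horth : ∀ ψ ∈ collisionInvariants E, maxwellianInner g ψ = 0) :
    ENNReal.ofReal (16 * ((finrank ℝ E : ℝ) - 1) / (3 * finrank ℝ E * (finrank ℝ E + 2)) *
        (sphereMeasure (univ : Set (sphere (0 : E) 1))).toReal) *
        ∫⁻ v, ENNReal.ofReal (g v ^ 2) ∂stdGaussian E ≤
      ∫⁻ ω, ∫⁻ q, ENNReal.ofReal (rectIncr (ω : E) g q ^ 2)
        ∂(((gaussianReal 0 1).prod (gaussianReal 0 1)).prod ((stdGaussian E).prod (stdGaussian E)))
        ∂(sphereMeasure : Measure (sphere (0 : E) 1)) := by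
  haveI := isFiniteMeasure_sphereMeasure (E := E)
  -- a reference orthonormal basis indexed by `Fin d`
  set ι := Fin (finrank ℝ E)
  have hcard : finrank ℝ E = Fintype.card ι := (Fintype.card_fin _).symm
  haveI : Nonempty ι := ⟨⟨0, by omega⟩⟩
  set b : OrthonormalBasis ι ℝ E := stdOrthonormalBasis ℝ E
  set κ : ℝ := 16 * ((finrank ℝ E : ℝ) - 1) / (3 * finrank ℝ E * (finrank ℝ E + 2)) *
    (sphereMeasure (univ : Set (sphere (0 : E) 1))).toReal with hκ
  have hκ0 : 0 ≤ κ := by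
    have : (2 : ℝ) ≤ finrank ℝ E := by exact_mod_cast hd2
    rw [hκ]
    refine mul_nonneg (div_nonneg (by linarith) (by positivity)) ENNReal.toReal_nonneg
  have hgc : Continuous g := hg.1.continuous
  have hgm : MemLp g 2 (stdGaussian E) :=
    (memLp_two_iff_integrable_sq hgc.aestronglyMeasurable).2
      ((integrable_stdGaussian_of_hasTemperateGrowth (hg.mul hg)).congr (ae_of_all _ fun v => by
        simp [sq]))
  -- orthogonality to the fluid Wick polynomials
  obtain ⟨m0, m1, m2⟩ := hermiteEval_fluid_mem_collisionInvariants (E := E) b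
  have horth0 := horth _ m0
  have horth1 : ∀ i, maxwellianInner g (hermiteEval b (MvPolynomial.X i : MvPolynomial ι ℝ)) = 0 :=
    fun i => horth _ (m1 i)
  have horth2 := horth _ m2
  -- the seminorms
  set A : (E → ℝ) → ℝ≥0∞ := fun f =>
    eLpNorm (fun x : sphere (0 : E) 1 × ((ℝ × ℝ) × (E × E)) => rectIncr (x.1 : E) f x.2) 2 ((sphereMeasure : Measure (sphere (0 : E) 1)).prod
          (((gaussianReal 0 1).prod (gaussianReal 0 1)).prod ((stdGaussian E).prod (stdGaussian E)))) with hA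
  set s : ℝ≥0∞ := sphereMeasure (univ : Set (sphere (0 : E) 1)) ^ (1 / 2 : ℝ) with hs
  have hsfin : s ≠ ⊤ := ENNReal.rpow_ne_top_of_nonneg (by norm_num) (measure_ne_top _ _)
  set kr : ℝ≥0∞ := ENNReal.ofReal (Real.sqrt κ) with hkr
  -- Step 1: `kr ‖g‖ ≤ A g`
  have hmain : kr * eLpNorm g 2 (stdGaussian E) ≤ A g := by
    refine ENNReal.le_of_forall_pos_le_add fun ε hε _ => ?_
    set M : ℝ≥0∞ := 4 * s + kr with hM
    have hMfin : M ≠ ⊤ := ENNReal.add_ne_top.2 ⟨ENNReal.mul_ne_top (by norm_num) hsfin, ENNReal.ofReal_ne_top⟩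
    set δ : ℝ := (ε : ℝ) / (M.toReal + 1) with hδ
    have hδ0 : 0 < δ := div_pos (by exact_mod_cast hε) (by positivity)
    have hMδ : M * ENNReal.ofReal δ ≤ ε := by
      rw [← ENNReal.ofReal_toReal hMfin, ← ENNReal.ofReal_mul ENNReal.toReal_nonneg,
        show ((ε : ℝ≥0) : ℝ≥0∞) = ENNReal.ofReal (ε : ℝ) by simp]
      refine ENNReal.ofReal_le_ofReal ?_
      rw [hδ, mul_div_assoc']
      rw [div_le_iff₀ (by positivity)]
      nlinarith [ENNReal.toReal_nonneg (a := M), (show (0 : ℝ) ≤ ε from ε.2)]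
    obtain ⟨p, hp0, hp1, hp2, hpε⟩ := exists_orthogonal_poly_approx b hgm horth0 horth1 horth2 hδ0
    set D : ℝ≥0∞ := eLpNorm (fun v => g v - hermiteEval b p v) 2 (stdGaussian E) with hD
    have hPc : Continuous (hermiteEval b p) := continuous_hermiteEval b p
    -- the polynomial gap for `p`, as `kr ‖𝓗p‖ ≤ A (𝓗p)`
    have hgap : kr * eLpNorm (hermiteEval b p) 2 (stdGaussian E) ≤ A (hermiteEval b p) := by
      have h := lintegral_sphere_rectForm_ge hd2 hcard b p hp0 hp1 hp2
      -- rewrite the inner Bochner integrals as `lintegral`s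
      have hinner : ∀ ω : sphere (0 : E) 1, ENNReal.ofReal (∫ q, rectIncr (ω : E) (hermiteEval b p) q ^ 2 ∂(((gaussianReal 0 1).prod (gaussianReal 0 1)).prod ((stdGaussian E).prod (stdGaussian E)))) =
          ∫⁻ q, ENNReal.ofReal (rectIncr (ω : E) (hermiteEval b p) q ^ 2) ∂(((gaussianReal 0 1).prod (gaussianReal 0 1)).prod ((stdGaussian E).prod (stdGaussian E))) := by
        intro ω
        obtain ⟨b', i₀, p', hb'ω, -, hp'eq, -⟩ := exists_adapted hcard b p le_rfl ω
        have hint : Integrable (fun q => rectIncr (ω : E) (hermiteEval b p) q ^ 2) (((gaussianReal 0 1).prod (gaussianReal 0 1)).prod ((stdGaussian E).prod (stdGaussian E))) := by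
          rw [← hb'ω, ← hp'eq]; exact integrable_rectIncr_sq_hermiteEval b' i₀ p'
        exact ofReal_integral_eq_lintegral_ofReal hint (ae_of_all _ fun q => sq_nonneg _)
      simp_rw [hinner] at h
      rw [← hκ, ← eLpNorm_rectIncr_sq hPc] at h
      have hN : ENNReal.ofReal (fischerInner p p) = eLpNorm (hermiteEval b p) 2 (stdGaussian E) ^ 2 := by
        rw [eLpNorm_two_sq_eq_lintegral, ← integral_hermiteEval_sq b p]
        exact ofReal_integral_eq_lintegral_ofReal (integrable_hermiteEval_sq b p)
          (ae_of_all _ fun v => sq_nonneg _)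
      rw [ENNReal.ofReal_mul hκ0, hN] at h
      -- take square roots
      have h2 := ENNReal.rpow_le_rpow h (show (0 : ℝ) ≤ 1 / 2 by norm_num)
      rw [ENNReal.mul_rpow_of_nonneg _ _ (by norm_num : (0 : ℝ) ≤ 1 / 2)] at h2
      have e1 : ENNReal.ofReal κ ^ (1 / 2 : ℝ) = kr := by
        rw [hkr, Real.sqrt_eq_rpow, ENNReal.ofReal_rpow_of_nonneg hκ0 (by norm_num)]
      have e2 : ∀ x : ℝ≥0∞, (x ^ 2) ^ (1 / 2 : ℝ) = x := fun x => by
        rw [one_div, show (2 : ℝ)⁻¹ = ((2 : ℕ) : ℝ)⁻¹ by norm_num]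
        exact ENNReal.pow_rpow_inv_natCast two_ne_zero x
      rwa [e1, e2, e2] at h2
    -- triangle inequalities
    have hAm : ∀ f : E → ℝ, Continuous f → AEStronglyMeasurable
        (fun x : sphere (0 : E) 1 × ((ℝ × ℝ) × (E × E)) => rectIncr (x.1 : E) f x.2) ((sphereMeasure : Measure (sphere (0 : E) 1)).prod
          (((gaussianReal 0 1).prod (gaussianReal 0 1)).prod ((stdGaussian E).prod (stdGaussian E)))) := by
      intro f hf
      exact (Continuous.aestronglyMeasurable (by unfold rectIncr; fun_prop))
    have hT1 : A (hermiteEval b p) ≤ A g + A (hermiteEval b p - g) := by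
      have : (fun x : sphere (0 : E) 1 × ((ℝ × ℝ) × (E × E)) => rectIncr (x.1 : E) (hermiteEval b p) x.2) =
          (fun x => rectIncr (x.1 : E) g x.2) + fun x => rectIncr (x.1 : E) (hermiteEval b p - g) x.2 := by
        funext x
        simp only [Pi.add_apply, ← rectIncr_add]
        congr 1
        funext v; simp
      simp only [hA]
      rw [this]
      exact eLpNorm_add_le (hAm g hgc) (hAm _ (hPc.sub hgc)) one_le_two
    have hT2 : A (hermiteEval b p - g) ≤ 4 * s * D := by
      refine (eLpNorm_rectIncr_le (hPc.sub hgc)).trans (le_of_eq ?_)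
      rw [hD, ← eLpNorm_neg]
      congr 2
      funext v; simp
    have hT3 : eLpNorm g 2 (stdGaussian E) ≤ eLpNorm (hermiteEval b p) 2 (stdGaussian E) + D := by
      have : g = hermiteEval b p + fun v => g v - hermiteEval b p v := by
        funext v; simp
      conv_lhs => rw [this]
      exact eLpNorm_add_le hPc.aestronglyMeasurable (hgc.sub hPc).aestronglyMeasurable one_le_two
    have hAfin : A g < ⊤ := by
      refine lt_of_le_of_lt (eLpNorm_rectIncr_le hgc) ?_
      exact ENNReal.mul_lt_top (ENNReal.mul_lt_top (by norm_num) hsfin.lt_top) hgm.eLpNorm_lt_top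
    have hT12 : A (hermiteEval b p) ≤ A g + 4 * s * D := hT1.trans (by gcongr)
    have hDδ : D ≤ ENNReal.ofReal δ := hpε.le
    calc kr * eLpNorm g 2 (stdGaussian E) ≤ kr * (eLpNorm (hermiteEval b p) 2 (stdGaussian E) + D) := by gcongr
      _ = kr * eLpNorm (hermiteEval b p) 2 (stdGaussian E) + kr * D := mul_add _ _ _
      _ ≤ A (hermiteEval b p) + kr * D := by gcongr
      _ ≤ (A g + 4 * s * D) + kr * D := by gcongr
      _ = A g + M * D := by rw [hM]; ring
      _ ≤ A g + M * ENNReal.ofReal δ := by gcongr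
      _ ≤ A g + ε := by gcongr
  -- Step 2: square
  have hsq := pow_le_pow_left' hmain 2
  rw [mul_pow, eLpNorm_two_sq_eq_lintegral, hA, eLpNorm_rectIncr_sq hgc] at hsq
  have hkr2 : kr ^ 2 = ENNReal.ofReal κ := by
    rw [hkr, ← ENNReal.ofReal_pow (Real.sqrt_nonneg _), Real.sq_sqrt hκ0]
  rwa [hkr2] at hsq

end Extension

/-! ### The spectral gap -/

section Main

variable {E : Type*} [NormedAddCommGroup E] [InnerProductSpace ℝ E] [FiniteDimensional ℝ E]
  [MeasurableSpace E] [BorelSpace E]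

/-- The sphere has positive, finite surface measure (`d ≥ 1`). [folklore] -/
theorem sphereMeasure_univ_toReal_pos (hE : 0 < finrank ℝ E) :
    0 < (sphereMeasure (univ : Set (sphere (0 : E) 1))).toReal := by
  haveI := isFiniteMeasure_sphereMeasure (E := E)
  refine ENNReal.toReal_pos ?_ (measure_ne_top _ _)
  change (volume : Measure E).toSphere univ ≠ 0
  haveI : Nontrivial E := Module.nontrivial_of_finrank_pos hE
  rw [Measure.toSphere_apply_univ]
  refine mul_ne_zero ?_ (measure_ball_pos volume (0 : E) one_pos).ne'
  exact_mod_cast hE.ne'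

/-- **Discharge of `le_neg_maxwellianInner_hardSphereLinearizedOp_of_orthogonal`** — the spectral gap
of the linearised hard-sphere Boltzmann operator (Grad 1963, quantitative form): in dimension
`d ≥ 2`, `-⟨g, Lg⟩_M ≥ λ ⟨g, g⟩_M` for all temperate `g ⊥` collision invariants, with
`λ = κ_d / (8 C₁)`, `κ_d = 16 σ(S^{d-1}) (d-1)/(3d(d+2))`, `C₁` the Gaussian hard-rod constant.
Proof: fibre reduction + one-dimensional coercivity (`LinearizedBoltzmannFibreReduction`), the
polynomial gap of the rectangle form (`LinearizedBoltzmannPseudoMaxwellianGap`) and density of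
polynomials (`GaussianPolynomialDensity`). [cite: Grad1963, §4] -/
theorem le_neg_maxwellianInner_hardSphereLinearizedOp_of_orthogonal_holds :
    le_neg_maxwellianInner_hardSphereLinearizedOp_of_orthogonal (E := E) := by
  intro hE
  have hE0 : 0 < finrank ℝ E := by omega
  set σr : ℝ := (sphereMeasure (univ : Set (sphere (0 : E) 1))).toReal with hσr
  set C₁ : ℝ≥0∞ := 1 + 4 * (min (gaussianReal 0 1 (Set.Ici 2)) (gaussianReal 0 1 (Set.Iic (-2))))⁻¹ with hC₁
  set C₁r : ℝ := C₁.toReal with hC₁r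
  set κ : ℝ := 16 * ((finrank ℝ E : ℝ) - 1) / (3 * finrank ℝ E * (finrank ℝ E + 2)) * σr with hκ
  have hσ0 : 0 < σr := sphereMeasure_univ_toReal_pos hE0
  have hd2 : (2 : ℝ) ≤ finrank ℝ E := by exact_mod_cast hE
  have hκ0 : 0 < κ := by
    rw [hκ]
    refine mul_pos (div_pos (by linarith) (by positivity)) hσ0
  have hC₁0 : 0 < C₁r := by
    rw [hC₁r]
    refine ENNReal.toReal_pos ?_ hardRod_gaussianReal_const_ne_top
    exact ne_of_gt (lt_of_lt_of_le zero_lt_one le_self_add)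
  refine ⟨κ / (8 * C₁r), div_pos hκ0 (by positivity), fun g hg horth => ?_⟩
  rw [mem_temperateGrowth_iff] at hg
  obtain ⟨hB, hQfin⟩ := rectForm_toReal_le_neg_maxwellianInner (E := E) hg
  have hD := kappa_mul_lintegral_sq_le_rectForm hE hg horth
  -- `⟨g, g⟩ = (∫ g² dγ).toReal`
  have hgg : maxwellianInner g g = (∫⁻ v, ENNReal.ofReal (g v ^ 2) ∂stdGaussian E).toReal := by
    unfold maxwellianInner
    rw [integral_eq_lintegral_of_nonneg_ae (ae_of_all _ fun v => mul_self_nonneg (g v))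
      (hg.1.continuous.mul hg.1.continuous).aestronglyMeasurable]
    congr 1
    refine lintegral_congr fun v => ?_
    rw [sq]
  have hD' := ENNReal.toReal_mono hQfin hD
  rw [ENNReal.toReal_mul, ENNReal.toReal_ofReal hκ0.le, ← hgg] at hD'
  -- combine
  rw [div_mul_eq_mul_div, div_le_iff₀ (by positivity)]
  calc κ * maxwellianInner g g ≤ _ := hD'
    _ ≤ 8 * C₁r * -maxwellianInner g (hardSphereLinearizedOp g) := hB
    _ = -maxwellianInner g (hardSphereLinearizedOp g) * (8 * C₁r) := by ring

end Main

end

end Literature.Analysis.UnboundedOperators
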